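import Summits.CriticalPhenomena.PercolationContinuityZ3.Theorems.Transplant.SiteVdBHKTwoCluster
import Summits.CriticalPhenomena.PercolationContinuityZ3.Theorems.Transplant.SiteAGlocOfGen
import HarnessLib

/-!
# SITE percolation: the pre-FKG projection step — `F(C_k) − F(C_c)` projected on `σ(C_k)` inside `{k ↮ c}`
# (site twin of `Theorems/PercNearOneGluingNoHeavyLowerTailCovTauTransfer.lean` §tower; lane `prim-bschramm` C1a,
# prover `prim-hp-8` gen 17 — first file of the SITE Kozma–Nitzan Conjecture 4 / 2 transplant)

builds on p205010 (kernel theorem, internal audit signed; external expert review pending).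

In the bond chain the pre-FKG peeling (`PreFKGSurplus.preMargin_nonneg_of_csh`, prim-ineq-gen-6) feeds the conditioned slack
hierarchy with the MONOTONE projected functional `G_k(K) = F(span K) − E[F(C_c) | C_k = K]` of the peeled relay `k`
(vdBHK Lemma 2.4: given `C_k = K` with `c ∉ K`, the cluster of `c` is fresh percolation off the pairs meeting `K`).
SITE version (this file): given the site cluster `C_k = K` and `c ∉ K`, the cluster of `c` is the cluster of `c` in the
configuration with the block `A(K) = {k} ∪ K ∪ ∂K` closed (`SiteBHK2.bar`, `SiteBHK2.siteCluster_eq_sdiff_bar`), and the states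
off `A(K)` are fresh (`SiteBHK2.sum_cond_cluster`, display (10) of vdBHK for the site model, p1):
* `SitePreFKG.tower_clusterFun` — `∫_{D ∩ {C_k ∈ 𝒮}} F(C_c) dμ = ∫_{D ∩ {C_k ∈ 𝒮}} g(C_k) dμ`, `D = {c ∉ C_k}`,
  `g(K) = ∫ F(C_c(η ∖ A(K))) dμ(η)`;
* `SitePreFKG.antitone_condMean`, `SitePreFKG.monotone_projFun` — `K ↦ g(K)` is decreasing, `K ↦ F(K) − g(K)` increasing;
* `SitePreFKG.setIntegral_sub_eq_projFun` — `∫ (F(C_k) − F(C_c)) = ∫ (F − g)(C_k)` on `σ(C_k)`-events inside `D`.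
Support file (`--supports stmt-CriticalPhenomena-4575 --as helper`); no definitions, no named facts, no sorries.
[cite: VandenbergHaggstromKahn2005, §1 pp. 7–8 display (10), §2.1 Lemma 2.4 (p. 10)] [cite: KozmaNitzan2024, Conj. 4 (p. 32)]
-/

noncomputable section

namespace Summit.CriticalPhenomena.PercolationContinuityZ3.Theorems.Transplant

namespace SitePreFKG

open MeasureTheory Set
open Literature.Probability.LatticeModels (prodBernoulli)
open Literature.Probability.Percolation
open Literature.Probability.Percolation.BHK2006 (weight weight_nonneg integral_prodBernoulli_eq_sum)
open DecisionTree (ind ind_of_mem ind_of_not_mem)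
open SiteBHK2 (bar bar_mono siteCluster_mono sum_cond_cluster)
open scoped Classical

variable {V : Type*} [Fintype V] {Γ : SimpleGraph V}

/-- **Tower property along `σ(C_k)` on `{k ↮ c}`, site model.**  For any `F` on vertex sets and any family `𝒮` of vertex sets:
`∫_{D ∩ {C_k ∈ 𝒮}} F(C_c) dμ = ∫_{D ∩ {C_k ∈ 𝒮}} g(C_k) dμ` with `D = {c ∉ C_k}` and `g(K) = ∫ F(C_c(η ∖ A(K))) dμ(η)`,
`A(K) = {k} ∪ K ∪ ∂K` (`SiteBHK2.bar`). [cite: VandenbergHaggstromKahn2005, §1 pp. 7–8 display (10), §2.1 Lemma 2.4 (p. 10)] -/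
theorem tower_clusterFun (q : V → unitInterval) (c k : V) (F : Set V → ℝ) (𝒮 : Set (Set V)) :
    ∫ ω in {ω : Set V | c ∉ siteCluster Γ ω k} ∩ {ω | siteCluster Γ ω k ∈ 𝒮}, F (siteCluster Γ ω c) ∂(prodBernoulli q) =
      ∫ ω in {ω : Set V | c ∉ siteCluster Γ ω k} ∩ {ω | siteCluster Γ ω k ∈ 𝒮},
        (∫ η, F (siteCluster Γ (η \ bar Γ k (siteCluster Γ ω k)) c) ∂(prodBernoulli q)) ∂(prodBernoulli q) := by
  set μ := prodBernoulli q with hμ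
  set D : Set (Set V) := {ω : Set V | c ∉ siteCluster Γ ω k} with hD
  have hDmem : ∀ ω, ω ∈ D ↔ c ∉ siteCluster Γ ω k := fun ω => Iff.rfl
  set q' : V → ℝ := fun v => (q v : ℝ) with hq'
  have hm : ∑ ω, weight q' ω = 1 := by
    have h1 := integral_prodBernoulli_eq_sum q fun _ => (1 : ℝ)
    simp only [integral_const, probReal_univ, smul_eq_mul, mul_one] at h1
    exact h1.symm
  -- display (10) with `H(K, L) = 1_𝒮(K) · F(L)`
  have key := sum_cond_cluster (Γ := Γ) q' hm k c (fun K L => ind 𝒮 K * F L) hDmem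
  rw [← integral_indicator (MeasurableSet.of_discrete), ← integral_indicator (MeasurableSet.of_discrete),
    integral_prodBernoulli_eq_sum, integral_prodBernoulli_eq_sum]
  have hL : ∀ ω : Set V, (D ∩ {ω | siteCluster Γ ω k ∈ 𝒮}).indicator (fun ω => F (siteCluster Γ ω c)) ω =
      ind 𝒮 (siteCluster Γ ω k) * F (siteCluster Γ ω c) * ind D ω := by
    intro ω
    by_cases h1 : ω ∈ D
    · by_cases h2 : siteCluster Γ ω k ∈ 𝒮
      · rw [indicator_of_mem (show ω ∈ D ∩ {ω | siteCluster Γ ω k ∈ 𝒮} from ⟨h1, h2⟩), ind_of_mem h1, ind_of_mem h2]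
        ring
      · rw [indicator_of_notMem (fun h => h2 h.2), ind_of_not_mem h2]; ring
    · rw [indicator_of_notMem (fun h => h1 h.1), ind_of_not_mem h1]; ring
  have hR : ∀ ω : Set V, (D ∩ {ω | siteCluster Γ ω k ∈ 𝒮}).indicator
      (fun ω => ∫ η, F (siteCluster Γ (η \ bar Γ k (siteCluster Γ ω k)) c) ∂μ) ω =
      (∑ η : Set V, weight q' η * (ind 𝒮 (siteCluster Γ ω k) * F (siteCluster Γ (η \ bar Γ k (siteCluster Γ ω k)) c))) *
        ind D ω := by
    intro ω
    have hint : ∫ η, F (siteCluster Γ (η \ bar Γ k (siteCluster Γ ω k)) c) ∂μ =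
        ∑ η : Set V, weight q' η * F (siteCluster Γ (η \ bar Γ k (siteCluster Γ ω k)) c) := integral_prodBernoulli_eq_sum q _
    by_cases h1 : ω ∈ D
    · by_cases h2 : siteCluster Γ ω k ∈ 𝒮
      · rw [indicator_of_mem (show ω ∈ D ∩ {ω | siteCluster Γ ω k ∈ 𝒮} from ⟨h1, h2⟩), ind_of_mem h1, ind_of_mem h2, hint]
        simp only [one_mul, mul_one]
      · rw [indicator_of_notMem (fun h => h2 h.2), ind_of_not_mem h2]
        simp only [zero_mul, mul_zero, Finset.sum_const_zero]
    · rw [indicator_of_notMem (fun h => h1 h.1), ind_of_not_mem h1]; ring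
  simp only [hL, hR]
  simpa [mul_assoc] using key

/-- **`K ↦ E[F(C_c) | C_k = K]` is decreasing** for `F` monotone: a larger `K` closes a larger block `A(K)`, and the cluster of `c`
in the thinned configuration can only shrink. [cite: VandenbergHaggstromKahn2005, §2.2 p. 12] -/
theorem antitone_condMean (q : V → unitInterval) (c k : V) (F : Set V → ℝ) (hF : ∀ S T : Set V, S ⊆ T → F S ≤ F T) :
    Antitone fun K : Set V => ∫ η, F (siteCluster Γ (η \ bar Γ k K) c) ∂(prodBernoulli q) := by
  intro K K' hKK'
  refine integral_mono (Integrable.of_finite) (Integrable.of_finite) fun η => ?_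
  exact hF _ _ (siteCluster_mono c (sdiff_subset_sdiff_right (bar_mono k hKK')))

/-- **The site Kozma–Nitzan functional projected on `σ(C_k)`**: `G(K) = F(K) − E[F(C_c) | C_k = K]` is a MONOTONE function of
the peeled relay's site cluster. [cite: KozmaNitzan2024, §5.1 (p. 31)] [cite: VandenbergHaggstromKahn2005, §2.2 p. 12] -/
theorem monotone_projFun (q : V → unitInterval) (c k : V) (F : Set V → ℝ) (hF : ∀ S T : Set V, S ⊆ T → F S ≤ F T) :
    Monotone fun K : Set V => F K - ∫ η, F (siteCluster Γ (η \ bar Γ k K) c) ∂(prodBernoulli q) :=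
  fun _ _ hKK' => sub_le_sub (hF _ _ hKK') (antitone_condMean q c k F hF hKK')

/-- **The projection identity**: on `D ∩ {C_k ∈ 𝒮}` (`D = {c ∉ C_k}`),
`∫ (F(C_k) − F(C_c)) dμ = ∫ G(C_k) dμ` with `G` the projected functional of `monotone_projFun`.
[cite: VandenbergHaggstromKahn2005, §2.1 Lemma 2.4 (p. 10)] -/
theorem setIntegral_sub_eq_projFun (q : V → unitInterval) (c k : V) (F : Set V → ℝ) (𝒮 : Set (Set V)) :
    ∫ ω in {ω : Set V | c ∉ siteCluster Γ ω k} ∩ {ω | siteCluster Γ ω k ∈ 𝒮},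
        (F (siteCluster Γ ω k) - F (siteCluster Γ ω c)) ∂(prodBernoulli q) =
      ∫ ω in {ω : Set V | c ∉ siteCluster Γ ω k} ∩ {ω | siteCluster Γ ω k ∈ 𝒮},
        (F (siteCluster Γ ω k) - ∫ η, F (siteCluster Γ (η \ bar Γ k (siteCluster Γ ω k)) c) ∂(prodBernoulli q))
          ∂(prodBernoulli q) := by
  rw [integral_sub (Integrable.of_finite).integrableOn (Integrable.of_finite).integrableOn,
    integral_sub (Integrable.of_finite).integrableOn (Integrable.of_finite).integrableOn,
    tower_clusterFun]

end SitePreFKG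

end Summit.CriticalPhenomena.PercolationContinuityZ3.Theorems.Transplant
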